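import Mathlib
import Summits.NavierStokesRegularity.Statement
import Literature.Analysis.FluidPDE.ClassicalSolution
import Literature.Analysis.FluidPDE.LerayHopf
import Literature.Analysis.FluidPDE.AxisymmetricEuler
import Literature.Analysis.FluidPDE.AxisymmetricReflection
import Summits.NavierStokesRegularity.NavierStokesRegularity.Theorems.ScenarioCensusForwardFrames
import HarnessLib

/-!
# The swirl-free endpoint of the dihedral family (route RootDecompDihedralHorizon, aside `EndpointCell`)

The `m = ∞` member of the dihedral family `D_m` (cyclic of every order about the axis `e₃` = axisymmetric, AND mirror-equivariant
across the meridian plane `{x₁ = 0}`, tree `Literature.Analysis.FluidPDE.reflY`) is the SWIRL-FREE axisymmetric class: for an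
axisymmetric field the mirror clause is exactly «no swirl» (tree `IsAxisymmetric.hasNoSwirl_iff_reflY`, Majda–Bertozzi 2002 §2.3.3),
and the swirl-free class is blow-up free for every blow-up type (census row F3c, `Theorems.ScenarioCensus.row_F3c_excluded`:
Ladyzhenskaya / Ukhovskii–Yudovich 1968 via Lemarié-Rieusset 2016 Thm 10.4). The conclusion `endpointCell_holds` is literally the
route's aside `EndpointCell` (lens-5 g3 kernel `cell_endpoint`, writer g29 port over the tree lemma). [cite: LemarieRieusset2016, Thm 10.4]
-/

set_option linter.dupNamespace false

open Literature.Analysis.FluidPDE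

namespace Summit.NavierStokesRegularity.NavierStokesRegularity.Theorems.RootDecompDihedralHorizonEndpoint

/-- THE ENDPOINT IS DECIDED: the cell of axisymmetric, mirror-equivariant (`reflY`), rapidly decaying classical Leray–Hopf data is
blow-up free (statement = the route aside `RootDecompDihedralHorizon.EndpointCell`, verbatim). [cite: LemarieRieusset2016, Thm 10.4] -/
theorem endpointCell_holds : ∀ (ν T : ℝ), 0 < ν → 0 < T → ∀ (u : ℝ → EuclideanSpace ℝ (Fin 3) → EuclideanSpace ℝ (Fin 3)) (p : ℝ → EuclideanSpace ℝ (Fin 3) → ℝ), Literature.Analysis.FluidPDE.IsClassicalNSSolutionOn (Set.Ico 0 T) ν 0 u p → Literature.Analysis.FluidPDE.IsLerayHopfOn T ν 0 (u 0) u → Literature.Analysis.FluidPDE.HasRapidSpatialDecay (u 0) → (Literature.Analysis.FluidPDE.IsAxisymmetric (u 0) ∧ (∀ x : EuclideanSpace ℝ (Fin 3), u 0 (Literature.Analysis.FluidPDE.reflY x) = Literature.Analysis.FluidPDE.reflY (u 0 x))) → Literature.Analysis.FluidPDE.HasSmoothExtensionPast ν 0 u T := by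
  intro ν T hν hT u p hcl hLH hdec hP
  exact Summit.NavierStokesRegularity.NavierStokesRegularity.Theorems.ScenarioCensus.row_F3c_excluded ν T hν hT u p hcl hLH hdec hP.1
    (hP.1.hasNoSwirl_iff_reflY.2 hP.2)

end Summit.NavierStokesRegularity.NavierStokesRegularity.Theorems.RootDecompDihedralHorizonEndpoint
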